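import Summits.HodgeConjecture.HodgeConjecture.Theorems.PadicSemiregularLiftPadicPridhamSemiregularityTraceConjugation
import Literature.AlgebraicGeometry.Modules.SheafHomLeft
import HarnessLib

/-!
# Dinaturality («cyclicity») of the contraction `𝓗om(E, E ⊗ G) → G` in the finite locally free module `E`

Cell `pub-hsemireg` (run/shared/lean/pub/pub-hsemireg/), Lean side (p3); K2-MIN piece (h0). HONEST FRAMING: a
module-level identity of sheaf algebra (real carriers: the tree's `sheafHom`, `contract`, frames); NOT a door, NOT a
fact, nothing about any variety, not a «K2 result».

For finite locally free `E₁`, `E₂`, any `𝒪_X`-module `G` and a morphism `φ : E₁ → E₂`, the two ways of contracting a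
section `ψ` of `𝓗om(E₂, 𝓗om(E₁^∨, G))` («`E₂ → E₁ ⊗ G`») agree: `str_{E₁}(ψ ∘ φ) = str_{E₂}((φ ⊗ 1) ∘ ψ)`, i.e.
`sheafHomMapLeft φ _ ≫ contract hE₁ G = sheafHomMap E₂ (twistMap φ G) ≫ contract hE₂ G` (`contract_dinatural`);
in frames `b_i, λ_i` of `E₁` and `c_j, μ_j` of `E₂` both sides are `∑_{i,j} μ_j(φ b_i) · ψ(c_j)(λ_i)` — `tr(PQ) = tr(QP)`
(`frameContract_comp_eq_frameContract_twist`, the two-bundle version of the tree's `frameContract_eq`). It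
generalises the tree's `contract_conj` (isomorphisms) and is the identity that makes the supertrace
`𝓗om•(E•, E• ⊗ G) → G[0]` of a complex with finite locally free terms a chain map (the `d_E`-terms cancel by it).

## References

* R. Hartshorne, *Algebraic Geometry*, GTM 52 (1977), II Ex. 5.1 (b) (`𝓗om(E, F) ≅ E^∨ ⊗ F`, contraction). [Hartshorne1977]
* R.-O. Buchweitz, H. Flenner, Compositio Math. 137 (2003), §4 (trace maps). [BuchweitzFlenner2003]
-/

noncomputable section

open CategoryTheory CategoryTheory.Limits AlgebraicGeometry Opposite TopologicalSpace
  Literature.AlgebraicGeometry.Motives Literature.AlgebraicGeometry.Modules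
  Summit.HodgeConjecture.HodgeConjecture.Theorems.PadicPridhamSemiregularity

universe u

namespace Summit.Ventures.HSemireg

variable {X : Scheme.{u}} {E₁ E₂ : X.Modules} (G : X.Modules) {W : X.Opens} {I J : Type u}
  [Fintype I] [Fintype J]

/-- **Cyclicity in frames**: for frames `e₁` of `E₁|_W` (basis `b_i`, dual basis `λ_i`) and `e₂` of `E₂|_W`
(basis `c_j`, dual basis `μ_j`), a morphism `φ : E₁ → E₂` and `ψ : E₂|_W → 𝓗om(E₁^∨, G)|_W`,
`∑_i ψ(φ b_i)(λ_i) = ∑_j ψ(c_j)(μ_j ∘ φ)` (both equal `∑_{i,j} μ_j(φ b_i) ψ(c_j)(λ_i)`). [folklore] -/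
theorem frameContract_comp_eq_frameContract_twist (e₁ : SheafOfModules.free I ≅ E₁.over W)
    (e₂ : SheafOfModules.free J ≅ E₂.over W) (φ : E₁ ⟶ E₂)
    (ψ : E₂.over W ⟶ (sheafHom (dual E₁) G).over W) :
    frameContract G e₁ ((SheafOfModules.overFunctor _ W).map φ ≫ ψ) =
      frameContract G e₂ (ψ ≫ (SheafOfModules.overFunctor _ W).map (twistMap φ G)) := by
  -- the values `Ψ_j = ψ(c_j)` and the matrix `a j i = μ_j(φ b_i)`
  set Ψ : J → ((dual E₁).over W ⟶ G.over W) := fun j =>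
    (appLE ψ (𝟙 W) (basisSection e₂ j) : (dual E₁).over W ⟶ G.over W) with hΨ
  set a : J → I → Γ(X, W) := fun j i => coord e₂ (𝟙 W) (φ.app W (basisSection e₁ i)) j with ha
  -- expand `ψ(φ b_i)` in the frame `e₂`
  have hL : ∀ i, (appLE ((SheafOfModules.overFunctor _ W).map φ ≫ ψ) (𝟙 W) (basisSection e₁ i) :
      (dual E₁).over W ⟶ G.over W) = ∑ j, a j i • Ψ j := by
    intro i
    rw [appLE_comp, appLE_over_map]
    have h := appLE_eq_sum_coord e₂ ψ (𝟙 W) (φ.app W (basisSection e₁ i))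
    simp only [presheaf_map_id] at h
    exact h
  -- the transposed dual vectors `μ_j ∘ φ`, expanded in the dual frame of `e₁`
  have hR : ∀ j, (appLE (ψ ≫ (SheafOfModules.overFunctor _ W).map (twistMap φ G)) (𝟙 W)
      (basisSection e₂ j) : (dual E₂).over W ⟶ G.over W) =
      (SheafOfModules.overFunctor _ W).map (sheafHomPrecomp φ (unitModule X)) ≫ Ψ j := by
    intro j
    rw [appLE_comp, appLE_over_map, sheafHomPrecomp_app_apply]
  have hμ : ∀ j, ((sheafHomPrecomp φ (unitModule X)).app W (dualBasis e₂ j) :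
      E₁.over W ⟶ (unitModule X).over W) = ∑ i, a j i • dualBasis e₁ i := by
    intro j
    rw [sheafHomPrecomp_app_apply]
    have h := eq_sum_smul_dualBasis e₁ ((SheafOfModules.overFunctor _ W).map φ ≫ dualBasis e₂ j)
    refine h.trans (Finset.sum_congr rfl fun i _ => ?_)
    rw [dualCoord_def, appLE_comp, appLE_over_map]
    rfl
  calc frameContract G e₁ ((SheafOfModules.overFunctor _ W).map φ ≫ ψ)
      = ∑ i, ∑ j, a j i • appLE (Ψ j) (𝟙 W) (dualBasis e₁ i : E₁.over W ⟶ (unitModule X).over W) := by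
        unfold frameContract
        refine Finset.sum_congr rfl fun i _ => ?_
        rw [hL i, appLE_sum_smul_left]
    _ = ∑ j, ∑ i, a j i • appLE (Ψ j) (𝟙 W) (dualBasis e₁ i : E₁.over W ⟶ (unitModule X).over W) :=
        Finset.sum_comm
    _ = ∑ j, appLE (Ψ j) (𝟙 W)
          (((sheafHomPrecomp φ (unitModule X)).app W (dualBasis e₂ j) :
            E₁.over W ⟶ (unitModule X).over W) : Γ(dual E₁, W)) := by
        refine Finset.sum_congr rfl fun j _ => ?_
        rw [hμ j, appLE_sum_smul_right]
    _ = frameContract G e₂ (ψ ≫ (SheafOfModules.overFunctor _ W).map (twistMap φ G)) := by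
        unfold frameContract
        refine Finset.sum_congr rfl fun j _ => ?_
        rw [hR j, appLE_comp, appLE_over_map]

/-- **Dinaturality of the contraction in the bundle** (`tr(PQ) = tr(QP)`): for finite locally free
`E₁`, `E₂`, a morphism `φ : E₁ → E₂` and any `G`, contracting `ψ ∘ φ` over `E₁` equals contracting
`(φ ⊗ 1) ∘ ψ` over `E₂`, for every section `ψ` of `𝓗om(E₂, 𝓗om(E₁^∨, G))`. [folklore] -/
theorem contract_dinatural (hE₁ : IsFiniteLocallyFree E₁) (hE₂ : IsFiniteLocallyFree E₂) (φ : E₁ ⟶ E₂) :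
    sheafHomMapLeft φ (sheafHom (dual E₁) G) ≫ contract hE₁ G =
      sheafHomMap E₂ (twistMap φ G) ≫ contract hE₂ G := by
  refine hom_ext_of_frames hE₂ fun W J _ e₂ ψ => ?_
  -- both sides are sections of `G` over `W`; compare them on the pieces of `W` framed for `E₁`
  refine TopCat.Sheaf.eq_of_locally_eq' ((SheafOfModules.toSheaf _).obj G)
    (fun x : W => piece hE₁ W x) W (fun x => Opens.infLELeft W (trivNbhd hE₁ x.1)) (le_iSup_piece hE₁)
    _ _ fun x => ?_
  set V := piece hE₁ W x
  set k : V ⟶ W := Opens.infLELeft W (trivNbhd hE₁ x.1)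
  change G.presheaf.map k.op ((sheafHomMapLeft φ _ ≫ contract hE₁ G).app W ψ) =
    G.presheaf.map k.op ((sheafHomMap E₂ (twistMap φ G) ≫ contract hE₂ G).app W ψ)
  rw [← Scheme.Modules.Hom.app_map_apply, ← Scheme.Modules.Hom.app_map_apply,
    Scheme.Modules.Hom.comp_app, Scheme.Modules.Hom.comp_app]
  change (contract hE₁ G).app V ((sheafHomMapLeft φ _).app V ((sheafHom E₂ _).presheaf.map k.op ψ)) =
    (contract hE₂ G).app V ((sheafHomMap E₂ (twistMap φ G)).app V ((sheafHom E₂ _).presheaf.map k.op ψ))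
  rw [sheafHomMapLeft_app_apply, sheafHomMap_app_apply,
    contract_app_eq_frameContract hE₁ G (pieceFrame hE₁ x),
    contract_app_eq_frameContract hE₂ G (SheafOfModules.restrictTrivialisation (R := X.ringCatSheaf) k e₂)]
  exact frameContract_comp_eq_frameContract_twist G (pieceFrame hE₁ x)
    (SheafOfModules.restrictTrivialisation (R := X.ringCatSheaf) k e₂) φ _

end Summit.Ventures.HSemireg

end
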